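import Summits.HodgeConjecture.HodgeConjecture.Theorems.R90S6HeckeProductCoordinates   -- ★ (H.0)(H.0b) `doubleCosetCoeff_mul_eq_ncard`, `eq_sum_doubleCosetCoeff_smul_doubleCosetOperator`
import Literature.NumberTheory.Automorphic.CartanDecompositionGLnPowers               -- ★ `exists_glInt_mul_mul_eq_zpowDiagGL` (Cartan, antitone exponents)
import Literature.NumberTheory.Automorphic.CartanDecompositionGLnUnique               -- ★ `CartanUnique.eq_of_glInt_mul_zpowDiagGL_mul_eq_of_antitone`
import Literature.NumberTheory.Automorphic.SatakeTransformGLInjective                 -- ★ `heckeAlgebra_gl_mul_comm` (for the consumers' `T_r * c_μ = c_μ * T_r`)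
import HarnessLib

/-!
# R90 · S6 «Ch. 14.1–14.5 stable TF» — WAVE 10 card W10-f (C.1)(C.2)(H.1-gen): THE CARTAN BASIS OF `ℋ(GL_n(K), GL_n(𝒪))` ON MATHLIB'S `HeckeCoset`
# AND THE EXPANSION OF AN ELEMENT WITH PRESCRIBED SUPPORT (`Theorems/R90S6GLCartanBasisExpansion.lean`; row E1.4.4.2.3, algebra half, generic `n`)

Cell `hodgecm-mathlib`, crux H413 (`stmt-HodgeConjecture-24833`), route of record `HCCMUnconditional`; programme R90-TF, section S6 (base `R90-C14`),
seat R90-C14-p06 (g0); S6 dealer R90-C14-plan (g2) CARD W10-f + RULING R1 (R90 bus 2026-09-05T00:45:01Z ∕ 00:49:11Z), junction with R90-C14-p10 (g0)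
(L3 `Theorems/R90S6GLThreePieriCounts.lean`: the counts `pieriCount r μ λ = #{γ ∈ K₀t_rK₀ ∕ K₀ : γ̃⁻¹ϖ^λ ∈ K₀ϖ^μK₀}`, 01:03:39Z «=»).  Sequel of ★
`Theorems/R90S6HeckeProductCoordinates.lean` (p863957): the GENERIC-`n` plumbing that turns coordinates into an element identity in the Cartan basis
`c_ν = T_{K₀ ϖ^ν K₀}` (`ν` antitone).  The `GL₃` Pieri formulas with p10's explicit coefficients and the `b`-recursion follow in
`Theorems/R90S6GLThreePieri.lean` ∕ `…BCPartnerCartanRecursion.lean` once p10's counts are ★.  Lane `--supports stmt-HodgeConjecture-24833 --as helper`;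
THEOREMS ONLY; letters = ★ p09's GL side (`{K : Type u} [Field K] [ValuativeRel K] [IsDiscreteValuationRing 𝒪[K]] {ϖ} (hϖ : IsUniformizingElement ϖ)`,
`[IsHeckeTriple ⊤ (glInt n K) (glInt n K)]`).

* **`exists_antitone_heckeCosetMk_zpowDiagGL_eq`** — (C.1) every `D : HeckeCoset ⊤ K₀ K₀` is `⟦ϖ^a⟧` with `a` antitone (★ `exists_glInt_mul_mul_eq_zpowDiagGL` read on
  Mathlib's `HeckeCoset` through ★ `toHeckeCoset_ofHeckeCoset` ∕ `heckeCosetMk_eq_iff`);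
* **`eq_of_heckeCosetMk_zpowDiagGL_eq`** — (C.2) `⟦ϖ^a⟧ = ⟦ϖ^b⟧` with `a`, `b` antitone forces `a = b` (★ `CartanUnique.eq_of_glInt_mul_zpowDiagGL_mul_eq_of_antitone`);
* **`eq_sum_doubleCosetCoeff_smul_cartan`** — (H.1-gen) if every antitone `ν` with a non-zero coordinate of `T` lies in a finite set `E` of antitone exponents then
  `T = Σ_{ν ∈ E} (coordinate of T at ⟦ϖ^ν⟧) • c_ν` (any commutative coefficient ring `k`).  With `T = c_μ · T_r` the coordinates ARE p10's `pieriCount r μ ν`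
  by ★ (H.0), so p10's support theorem + closed forms turn this into the explicit ≤ 3-term `GL₃` Pieri rule.

HONEST LABEL: Hecke-algebra bookkeeping, count-neutral until E1.4.4.2.3 consumes the Pieri layer; HC_CM is proved only modulo the 7 printed citations (2 remaining
named inputs: hLiu418 = stmt-HodgeConjecture-24832, h413 = stmt-HodgeConjecture-24833) until rung 0 closes; REL ≠ ★ ≠ BUILT.

## References
* [Macdonald1995] I. G. Macdonald, *Symmetric Functions and Hall Polynomials*, 2nd ed. (1995), Ch. V (2.1) (Cartan classes `K ϖ^λ K`), (2.6) (`c_μ c_ν = Σ g^λ_{μν}(q) c_λ`).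
* [BruhatTits1972] F. Bruhat, J. Tits, Publ. IHÉS 41 (1972), (4.4.3) (Cartan decomposition).
* [AndrianovZhuravlev2015] Ch. 3 §1.1 Lemma 1.5 (structure constants).
-/

set_option autoImplicit false
-- the mandated namespace repeats the single-problem summit's segment (`HodgeConjecture.HodgeConjecture`)
set_option linter.dupNamespace false

noncomputable section

open MulAction
open Literature.NumberTheory.Automorphic
open scoped MatrixGroups
open ValuativeRel

namespace Summit.HodgeConjecture.HodgeConjecture.R90.S6

universe u

variable {n : ℕ} {K : Type u} [Field K] [ValuativeRel K] [IsDiscreteValuationRing 𝒪[K]] {ϖ : K}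
  (hϖ : IsUniformizingElement ϖ)

/-- **(C.1) every double coset of `(GL_n(K), GL_n(𝒪))` is a Cartan class `K₀ ϖ^a K₀` with antitone exponents** (★ `exists_glInt_mul_mul_eq_zpowDiagGL`,
read on Mathlib's `HeckeCoset`). [cite: Macdonald1995, Ch. V (2.1)] [cite: BruhatTits1972, (4.4.3)] -/
theorem exists_antitone_heckeCosetMk_zpowDiagGL_eq (D : HeckeCoset (⊤ : Submonoid (GL (Fin n) K)) (glInt n K) (glInt n K)) :
    ∃ a : Fin n → ℤ, Antitone a ∧
      HeckeCoset.mk (glInt n K) (glInt n K) ⟨zpowDiagGL hϖ.ne_zero a, Submonoid.mem_top _⟩ = D := by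
  -- a representative `x` of `D`
  set x : GL (Fin n) K := (heckeAlgebra.ofHeckeCoset (glInt n K) D).out with hx
  have hD : HeckeCoset.mk (glInt n K) (glInt n K) ⟨x, Submonoid.mem_top x⟩ = D := by
    rw [← heckeAlgebra.toHeckeCoset_coe, hx, QuotientGroup.out_eq', heckeAlgebra.toHeckeCoset_ofHeckeCoset]
  obtain ⟨k₁, hk₁, k₂, hk₂, a, ha, h⟩ := exists_glInt_mul_mul_eq_zpowDiagGL hϖ x
  refine ⟨a, ha, ?_⟩
  rw [← hD]
  symm
  exact (heckeAlgebra.heckeCosetMk_eq_iff (glInt n K) (Submonoid.mem_top x) (Submonoid.mem_top _)).2 ⟨k₁, hk₁, k₂, hk₂, h.symm⟩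

/-- **(C.2) antitone Cartan exponents are determined by their double coset** (★ `eq_of_glInt_mul_zpowDiagGL_mul_eq_of_antitone`).
[cite: Macdonald1995, Ch. V (2.1)] [cite: BruhatTits1972, (4.4.3)] -/
theorem eq_of_heckeCosetMk_zpowDiagGL_eq {a b : Fin n → ℤ} (ha : Antitone a) (hb : Antitone b)
    (h : HeckeCoset.mk (glInt n K) (glInt n K) ⟨zpowDiagGL hϖ.ne_zero a, Submonoid.mem_top _⟩ =
      HeckeCoset.mk (glInt n K) (glInt n K) ⟨zpowDiagGL hϖ.ne_zero b, Submonoid.mem_top _⟩) : a = b := by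
  obtain ⟨k₁, hk₁, k₂, hk₂, hk⟩ := (heckeAlgebra.heckeCosetMk_eq_iff (glInt n K) (Submonoid.mem_top _) (Submonoid.mem_top _)).1 h
  exact CartanUnique.eq_of_glInt_mul_zpowDiagGL_mul_eq_of_antitone hϖ ha hb hk₁ hk₂ hk.symm

variable [IsHeckeTriple (⊤ : Submonoid (GL (Fin n) K)) (glInt n K) (glInt n K)]

/-- **(H.1-gen) EXPANSION IN THE CARTAN BASIS WITH PRESCRIBED SUPPORT**: if every antitone exponent `ν` carrying a non-zero coordinate of `T` lies in the
finite set `E` of antitone exponents, then `T = Σ_{ν ∈ E} (coordinate of T at K₀ϖ^νK₀) • c_ν` ((H.0b) + (C.1) + (C.2)).  With the coordinates read by (H.0)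
(`= pieriCount`) and the support from p10's counts this is the element-level Pieri rule. [cite: Macdonald1995, Ch. V (2.6)] -/
theorem eq_sum_doubleCosetCoeff_smul_cartan {k : Type*} [CommRing k] (T : heckeAlgebra k (GL (Fin n) K) (glInt n K)) (E : Finset (Fin n → ℤ))
    (hE : ∀ ν ∈ E, Antitone ν)
    (hsupp : ∀ ν : Fin n → ℤ, Antitone ν →
      heckeAlgebra.doubleCosetCoeff (glInt n K) T (HeckeCoset.mk (glInt n K) (glInt n K) ⟨zpowDiagGL hϖ.ne_zero ν, Submonoid.mem_top _⟩) ≠ 0 → ν ∈ E) :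
    T = ∑ ν ∈ E, heckeAlgebra.doubleCosetCoeff (glInt n K) T (HeckeCoset.mk (glInt n K) (glInt n K) ⟨zpowDiagGL hϖ.ne_zero ν, Submonoid.mem_top _⟩) •
      heckeAlgebra.doubleCosetOperator (glInt n K) (zpowDiagGL hϖ.ne_zero ν) := by
  classical
  have hmk : ∀ {a b : Fin n → ℤ}, zpowDiagGL hϖ.ne_zero a = zpowDiagGL hϖ.ne_zero b →
      HeckeCoset.mk (glInt n K) (glInt n K) ⟨zpowDiagGL hϖ.ne_zero a, Submonoid.mem_top _⟩ =
        HeckeCoset.mk (glInt n K) (glInt n K) ⟨zpowDiagGL hϖ.ne_zero b, Submonoid.mem_top _⟩ := fun h => by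
    simp_rw [h]
  have hinjz : Set.InjOn (fun ν : Fin n → ℤ => zpowDiagGL hϖ.ne_zero ν) E := fun a ha b hb h =>
    eq_of_heckeCosetMk_zpowDiagGL_eq hϖ (hE a ha) (hE b hb) (hmk h)
  refine (eq_sum_doubleCosetCoeff_smul_doubleCosetOperator (glInt n K) T (E.image fun ν => zpowDiagGL hϖ.ne_zero ν) ?_ ?_).trans ?_
  · intro x hx y hy hxy
    obtain ⟨a, ha, rfl⟩ := Finset.mem_image.1 (Finset.mem_coe.1 hx)
    obtain ⟨b, hb, rfl⟩ := Finset.mem_image.1 (Finset.mem_coe.1 hy)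
    exact congrArg _ (eq_of_heckeCosetMk_zpowDiagGL_eq hϖ (hE a ha) (hE b hb) hxy)
  · intro D hD
    obtain ⟨a, ha, rfl⟩ := exists_antitone_heckeCosetMk_zpowDiagGL_eq hϖ D
    exact ⟨_, Finset.mem_image_of_mem _ (hsupp a ha hD), rfl⟩
  · rw [Finset.sum_image hinjz]

end Summit.HodgeConjecture.HodgeConjecture.R90.S6

end
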